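import Literature.MathematicalPhysics.QuantumFieldTheory.Balaban1983to89.B4Eq19LatticeCaccioppoli
import Summits.QuantumFields.BalabanUV.Beta.SubsolutionCaccioppoli
import HarnessLib

/-!
# Route R of crux K1 «MinimiserStabilityRegPr» (stmt-QuantumFields-19200) — THE CACCIOPPOLI INEQUALITY FOR NONNEGATIVE SUBSOLUTIONS OF THE
# LATTICE LAPLACIAN ON `ℤ^d` (`−Δv ≤ 0`), AND LEVEL TRUNCATION — the elementary bricks of De Giorgi's INTERIOR iteration
# (file F1 of the sub-mean-value letter for subharmonic densities; cell `ym3-torus`, width seat `ym-ust-19200-w1` g6; ★routeR-w1 s2 shape (a);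
# `--supports stmt-QuantumFields-19200 --as helper`, count-neutral)

YM₃ on T³ is a RUNG of the ladder (R3), not the Clay problem; nothing here claims the stub, the crux or the gap.

WHY.  Route R's curved N7 on the pinned∕Hodge branch leaves the residue (JC′) (★routeR-w1 s2 LOCATE v1.2, 19200 evidence #58), whose analytic input is a
SUB-MEAN-VALUE inequality `z(x)² ≤ C_d·ℓ^{−d}·Σ_{Q_ℓ(x)} z²` for a NONNEGATIVE SUBHARMONIC lattice function `z` (Kato's `‖φ‖_F`, ✓`Prop7PinnedHarmonicMass`);
brick 1 (`Prop7FlatInteriorMeanValue.sq_le_of_harmonic`) has it for HARMONIC data only.  For subsolutions the road is De Giorgi's iteration in its Faber–Krahn form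
— the cell's own chain «LATTICE-DEGIORGI-MV» (`Beta.SubsolutionCaccioppoli` → `DeGiorgiStep` → `DeGiorgiIteration` → `SubsolutionMeanValueBox`, typed on the unit torus
`UT N`) — re-run on `ℤ^d` boxes in the letters of the tree's Campanato road, where the Faber–Krahn inequality is already in the tree (`Prop7FlatFaberKrahnZd.faberKrahn`,
p612230).  THIS FILE is the `ℤ^d` twin of `Beta.SubsolutionCaccioppoli` (generic finite carriers there; `ℤ^d` is infinite, so the three bricks are re-proved on boxes).

WHAT IS PROVED (sorry-free, no definition; a SUBSOLUTION on a finset `B` is `∀ y ∈ B, lop 0 v y ≤ 0`, i.e. `2d·v(y) ≤ Σ_μ (v(y+e_μ) + v(y−e_μ))`).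
* §1 `lop_zero_le_zero_iff` (the averaged form), ★ `posPart_sub_subsolution` — `(z − k)₊` of a subsolution is a NONNEGATIVE subsolution (Jensen).
* §2 (per-bond inequality `3(sa − tb)² ≤ 16(s²a − t²b)(a − b) + 38(s − t)²(a² + b²)` = the cell's ✓`Beta.SubsolutionCaccioppoli.per_bond`, imported)
  ★ `caccioppoli_sub` — for `v ≥ 0` a subsolution wherever `η ≠ 0`, `η` vanishing off `Q_{R−1}(z)`:
  `Σ_{Q_R(z)} Σ_μ (∂_μ(ηv))² ≤ 13·Σ_{Q_R(z)} Σ_μ (∂_μη)²·(v(y+e_μ)² + v(y)²)` (test `−Δv ≤ 0` against `η²v ≥ 0`, ✓`B4Eq19LatticeOperators.sum_mul_lop`, `per_bond`);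
  ★ `caccioppoli_sub_cutoff` — with `|∂η| ≤ 1∕s`: `… ≤ (26d∕s²)·Σ_{Q_{R+1}(z)} v²`.
* (Chebyshev `#{y ∈ S : μ < v(y)}·μ² ≤ Σ_S v²` is the cell's generic ✓`Beta.SubsolutionCaccioppoli.card_filter_mul_sq_le`, imported — not restated.)

HONEST SCOPE.  [folklore] finite lattice calculus (method pointer: Delmotte, Colloq. Math. 72 (1997) Lemme 5.1 — Caccioppoli on graphs; De Giorgi 1957); files F2 (the
De Giorgi step through `faberKrahn`) and F3 (the dyadic iteration + the sub-mean-value inequality + torus pullback) are separate.  Nothing of Bałaban's is asserted.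

References: M. Giaquinta, Princeton UP 1983 [Giaquinta1984] (Ch. III §2); T. Bałaban, CMP 96 (1984) 223–250 [Balaban1984PropagatorsII] ((1.9) p.226).
-/

set_option autoImplicit false

noncomputable section

open scoped BigOperators
open Finset

namespace Summit.QuantumFields.YangMills.Theorems.Prop7FlatSubsolutionCaccioppoli

open Literature.MathematicalPhysics.QuantumFieldTheory.Balaban1983to89
open B4Eq19LatticeOperators B4Eq19LatticeCaccioppoli

variable {d : ℕ}

/-! ## §1 Subsolutions and level truncation -/

/-- The averaged form of `−Δv(y) ≤ 0`: `2d·v(y) ≤ Σ_μ (v(y + e_μ) + v(y − e_μ))`. [folklore] -/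
theorem lop_zero_le_zero_iff (v : Zd d → ℝ) (y : Zd d) :
    lop 0 v y ≤ 0 ↔ 2 * (d : ℝ) * v y ≤ ∑ μ : Fin d, (v (y + unitVec μ) + v (y - unitVec μ)) := by
  rw [lop_apply, zero_mul, add_zero]
  have : ∑ μ : Fin d, (2 * v y - v (y + unitVec μ) - v (y - unitVec μ)) =
      2 * (d : ℝ) * v y - ∑ μ : Fin d, (v (y + unitVec μ) + v (y - unitVec μ)) := by
    simp only [Finset.sum_sub_distrib, Finset.sum_add_distrib, Finset.sum_const, Finset.card_univ, Fintype.card_fin, nsmul_eq_mul]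
    ring
  rw [this]
  constructor <;> intro h <;> linarith

/-- ★ **LEVEL TRUNCATION**: if `v` is a subsolution on `B` (`−Δv ≤ 0` there), then for every level `k` the truncation `(v − k)₊` is a NONNEGATIVE subsolution
on `B` (Jensen: `(a − k)₊` is convex nondecreasing, so `2d·(v(y) − k)₊ ≤ Σ_μ ((v(y±e_μ) − k)₊)`). [folklore] -/
theorem posPart_sub_subsolution {B : Finset (Zd d)} {v : Zd d → ℝ} (hv : ∀ y ∈ B, lop 0 v y ≤ 0) (k : ℝ) :
    ∀ y ∈ B, lop 0 (fun x => max (v x - k) 0) y ≤ 0 := by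
  intro y hy
  rw [lop_zero_le_zero_iff]
  have h := (lop_zero_le_zero_iff v y).mp (hv y hy)
  have hnn : 0 ≤ ∑ μ : Fin d, (max (v (y + unitVec μ) - k) 0 + max (v (y - unitVec μ) - k) 0) :=
    Finset.sum_nonneg fun μ _ => add_nonneg (le_max_right _ _) (le_max_right _ _)
  by_cases hk : v y - k ≤ 0
  · rw [max_eq_right hk, mul_zero]; exact hnn
  · push Not at hk
    rw [max_eq_left hk.le]
    have h2 : ∑ μ : Fin d, (v (y + unitVec μ) + v (y - unitVec μ)) - 2 * (d : ℝ) * k ≤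
        ∑ μ : Fin d, (max (v (y + unitVec μ) - k) 0 + max (v (y - unitVec μ) - k) 0) := by
      have e : ∑ μ : Fin d, (v (y + unitVec μ) + v (y - unitVec μ)) - 2 * (d : ℝ) * k =
          ∑ μ : Fin d, ((v (y + unitVec μ) - k) + (v (y - unitVec μ) - k)) := by
        rw [Finset.sum_add_distrib, Finset.sum_add_distrib, Finset.sum_sub_distrib, Finset.sum_sub_distrib, Finset.sum_const,
          Finset.card_univ, Fintype.card_fin, nsmul_eq_mul]
        ring
      rw [e]
      exact Finset.sum_le_sum fun μ _ => add_le_add (le_max_left _ _) (le_max_left _ _)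
    linarith

/-- A truncation is nonnegative. [folklore] -/
theorem posPart_nonneg (v : Zd d → ℝ) (k : ℝ) (y : Zd d) : 0 ≤ max (v y - k) 0 := le_max_right _ _

/-- Raising the level lowers the truncation: `(v − k′)₊ ≤ (v − k)₊` for `k ≤ k′`. [folklore] -/
theorem posPart_anti (v : Zd d → ℝ) {k k' : ℝ} (hkk : k ≤ k') (y : Zd d) : max (v y - k') 0 ≤ max (v y - k) 0 :=
  max_le_max (by linarith) le_rfl

/-! ## §2 Caccioppoli for nonnegative subsolutions -/

/-- **Testing a subsolution against `η²v` gives a nonpositive Dirichlet pairing**: `v ≥ 0`, `−Δv ≤ 0` wherever `η ≠ 0`, `η = 0` off `Q_{R−1}(z)` ⟹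
`Σ_{Q_R(z)} Σ_μ ∂_μ(η²v)·∂_μv ≤ 0` (✓`sum_mul_lop` with `φ = η²v ≥ 0`). [folklore] -/
theorem pairing_nonpos (η v : Zd d → ℝ) (hv : ∀ y, 0 ≤ v y) (z : Zd d) (R : ℤ) (hη0 : ∀ y ∉ box z (R - 1), η y = 0)
    (hsub : ∀ y, η y ≠ 0 → lop 0 v y ≤ 0) :
    ∑ y ∈ box z R, ∑ μ, fdiff μ (fun x => η x ^ 2 * v x) y * fdiff μ v y ≤ 0 := by
  have hφ0 : ∀ y ∉ box z (R - 1), (fun x => η x ^ 2 * v x) y = 0 := fun y hy => by simp only [hη0 y hy]; ring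
  have h := sum_mul_lop 0 (fun x => η x ^ 2 * v x) v z R hφ0
  rw [zero_mul, add_zero] at h
  rw [← h]
  refine Finset.sum_nonpos fun y _ => ?_
  by_cases hη : η y = 0
  · simp only [hη]; ring_nf; rfl
  · exact mul_nonpos_of_nonneg_of_nonpos (mul_nonneg (sq_nonneg _) (hv y)) (hsub y hη)

/-- ★ **THE DISCRETE CACCIOPPOLI INEQUALITY FOR NONNEGATIVE SUBSOLUTIONS ON `ℤ^d`.**  `v ≥ 0`, `−Δv ≤ 0` at every site where `η ≠ 0`, `η = 0` off `Q_{R−1}(z)`: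
`Σ_{Q_R(z)} Σ_μ (∂_μ(ηv))² ≤ 13·Σ_{Q_R(z)} Σ_μ (∂_μη)²·(v(y+e_μ)² + v(y)²)` — the energy of `ηv` is paid by the mass of `v` on the transition region of `η`.
[folklore] [cite: Giaquinta1984, Ch. III §2 (2.4) p.77] -/
theorem caccioppoli_sub (η v : Zd d → ℝ) (hv : ∀ y, 0 ≤ v y) (z : Zd d) (R : ℤ) (hη0 : ∀ y ∉ box z (R - 1), η y = 0)
    (hsub : ∀ y, η y ≠ 0 → lop 0 v y ≤ 0) :
    ∑ y ∈ box z R, ∑ μ, fdiff μ (fun x => η x * v x) y ^ 2 ≤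
      13 * ∑ y ∈ box z R, ∑ μ, fdiff μ η y ^ 2 * (v (y + unitVec μ) ^ 2 + v y ^ 2) := by
  have hS := pairing_nonpos η v hv z R hη0 hsub
  have hpt : ∀ (y : Zd d) (μ : Fin d), 3 * fdiff μ (fun x => η x * v x) y ^ 2 ≤
      16 * (fdiff μ (fun x => η x ^ 2 * v x) y * fdiff μ v y) + 38 * (fdiff μ η y ^ 2 * (v (y + unitVec μ) ^ 2 + v y ^ 2)) := by
    intro y μ
    simp only [fdiff_apply]
    exact Summit.QuantumFields.BalabanUV.Beta.SubsolutionCaccioppoli.per_bond (η (y + unitVec μ)) (η y) (v (y + unitVec μ)) (v y)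
  have hsum : 3 * ∑ y ∈ box z R, ∑ μ, fdiff μ (fun x => η x * v x) y ^ 2 ≤
      16 * ∑ y ∈ box z R, ∑ μ, fdiff μ (fun x => η x ^ 2 * v x) y * fdiff μ v y +
        38 * ∑ y ∈ box z R, ∑ μ, fdiff μ η y ^ 2 * (v (y + unitVec μ) ^ 2 + v y ^ 2) := by
    rw [Finset.mul_sum, Finset.mul_sum, Finset.mul_sum, ← Finset.sum_add_distrib]
    refine Finset.sum_le_sum fun y _ => ?_
    rw [Finset.mul_sum, Finset.mul_sum, Finset.mul_sum, ← Finset.sum_add_distrib]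
    exact Finset.sum_le_sum fun μ _ => hpt y μ
  have h0 : 0 ≤ ∑ y ∈ box z R, ∑ μ, fdiff μ η y ^ 2 * (v (y + unitVec μ) ^ 2 + v y ^ 2) :=
    Finset.sum_nonneg fun _ _ => Finset.sum_nonneg fun _ _ => by positivity
  linarith

/-- ★ **CACCIOPPOLI WITH A LIPSCHITZ CUTOFF.**  Under the hypotheses of `caccioppoli_sub` and `|∂_μη| ≤ 1∕s` on every bond (`s > 0`):
`Σ_{Q_R(z)} Σ_μ (∂_μ(ηv))² ≤ (26d∕s²)·Σ_{Q_{R+1}(z)} v²`. [folklore] [cite: Giaquinta1984, Ch. III §2 (2.4) p.77] -/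
theorem caccioppoli_sub_cutoff (η v : Zd d → ℝ) (hv : ∀ y, 0 ≤ v y) (z : Zd d) {R : ℤ} (hη0 : ∀ y ∉ box z (R - 1), η y = 0)
    (hsub : ∀ y, η y ≠ 0 → lop 0 v y ≤ 0) {s : ℝ} (hs : 0 < s) (hlip : ∀ (y : Zd d) (μ : Fin d), |fdiff μ η y| ≤ 1 / s) :
    ∑ y ∈ box z R, ∑ μ, fdiff μ (fun x => η x * v x) y ^ 2 ≤ 26 * d / s ^ 2 * ∑ y ∈ box z (R + 1), v y ^ 2 := by
  have hC := caccioppoli_sub η v hv z R hη0 hsub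
  have hsq : ∀ (y : Zd d) (μ : Fin d), fdiff μ η y ^ 2 ≤ 1 / s ^ 2 := fun y μ => by
    have h := hlip y μ
    calc fdiff μ η y ^ 2 = |fdiff μ η y| ^ 2 := (sq_abs _).symm
      _ ≤ (1 / s) ^ 2 := pow_le_pow_left₀ (abs_nonneg _) h 2
      _ = 1 / s ^ 2 := by rw [one_div, one_div, inv_pow]
  have h1 : ∑ y ∈ box z R, ∑ μ, fdiff μ η y ^ 2 * (v (y + unitVec μ) ^ 2 + v y ^ 2) ≤
      1 / s ^ 2 * (∑ y ∈ box z R, ∑ μ : Fin d, v (y + unitVec μ) ^ 2 + ∑ y ∈ box z R, ∑ μ : Fin d, v y ^ 2) := by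
    rw [← Finset.sum_add_distrib, Finset.mul_sum]
    refine Finset.sum_le_sum fun y _ => ?_
    rw [← Finset.sum_add_distrib, Finset.mul_sum]
    refine Finset.sum_le_sum fun μ _ => ?_
    have : 0 ≤ v (y + unitVec μ) ^ 2 + v y ^ 2 := by positivity
    calc fdiff μ η y ^ 2 * (v (y + unitVec μ) ^ 2 + v y ^ 2) ≤ 1 / s ^ 2 * (v (y + unitVec μ) ^ 2 + v y ^ 2) :=
          mul_le_mul_of_nonneg_right (hsq y μ) this
      _ = 1 / s ^ 2 * (v (y + unitVec μ) ^ 2 + v y ^ 2) := rfl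
  -- both mass sums are at most `d·Σ_{Q_{R+1}} v²`
  have hU1 : ∑ y ∈ box z R, ∑ μ : Fin d, v y ^ 2 ≤ d * ∑ y ∈ box z (R + 1), v y ^ 2 := by
    have e : ∑ y ∈ box z R, ∑ μ : Fin d, v y ^ 2 = d * ∑ y ∈ box z R, v y ^ 2 := by
      rw [Finset.mul_sum]
      refine Finset.sum_congr rfl fun y _ => ?_
      rw [Finset.sum_const, Finset.card_univ, Fintype.card_fin, nsmul_eq_mul]
    rw [e]
    exact mul_le_mul_of_nonneg_left (Finset.sum_le_sum_of_subset_of_nonneg (box_mono z (by linarith)) fun _ _ _ => sq_nonneg _)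
      (Nat.cast_nonneg d)
  have hU2 : ∑ y ∈ box z R, ∑ μ, v (y + unitVec μ) ^ 2 ≤ d * ∑ y ∈ box z (R + 1), v y ^ 2 := by
    rw [Finset.sum_comm]
    have : ∀ μ : Fin d, ∑ y ∈ box z R, v (y + unitVec μ) ^ 2 ≤ ∑ y ∈ box z (R + 1), v y ^ 2 := by
      intro μ
      rw [sum_box_add_right (fun y => v y ^ 2)]
      refine Finset.sum_le_sum_of_subset_of_nonneg (box_subset_box fun i => ?_) fun _ _ _ => sq_nonneg _
      simp only [Pi.add_apply, add_sub_cancel_left]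
      linarith [abs_unitVec_apply_le μ i]
    calc ∑ μ, ∑ y ∈ box z R, v (y + unitVec μ) ^ 2 ≤ ∑ μ : Fin d, ∑ y ∈ box z (R + 1), v y ^ 2 := Finset.sum_le_sum fun μ _ => this μ
      _ = d * ∑ y ∈ box z (R + 1), v y ^ 2 := by rw [Finset.sum_const, Finset.card_univ, Fintype.card_fin, nsmul_eq_mul]
  have hV : 0 ≤ ∑ y ∈ box z (R + 1), v y ^ 2 := Finset.sum_nonneg fun _ _ => sq_nonneg _
  have hs2 : 0 < 1 / s ^ 2 := by positivity
  calc ∑ y ∈ box z R, ∑ μ, fdiff μ (fun x => η x * v x) y ^ 2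
      ≤ 13 * ∑ y ∈ box z R, ∑ μ, fdiff μ η y ^ 2 * (v (y + unitVec μ) ^ 2 + v y ^ 2) := hC
    _ ≤ 13 * (1 / s ^ 2 * (d * ∑ y ∈ box z (R + 1), v y ^ 2 + d * ∑ y ∈ box z (R + 1), v y ^ 2)) := by
        have := mul_le_mul_of_nonneg_left (add_le_add hU2 hU1) hs2.le
        nlinarith [h1]
    _ = 26 * d / s ^ 2 * ∑ y ∈ box z (R + 1), v y ^ 2 := by ring

end Summit.QuantumFields.YangMills.Theorems.Prop7FlatSubsolutionCaccioppoli

end
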